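import Summits.KontsevichZagierPeriods.KontsevichZagierPeriods.Theorems.RootDecompQuadraticDescentZetaTwoPairsP2

/-!
# The ZETA2 stratum (15 census pairs among R1..R6 ∈ π²ℚ) DECIDED in `KZ.relations` (route `RootDecompQuadraticDescent`, instances of crux stmt-KontsevichZagierPeriods-28994 / stmt-4280) · part 3/5

Cell `decomp-kz`, lens 6 (decomp-kz-lens-6 g8b): ENGINE v3.1 — the bounded «triangle calculus» on sub-graph representations `SB(c;L,U)` (`sb_cut/affine/swap/unfold/add′`, `rel_opn/scale/shift/powB` ⟹ `sb_pow`; `rel_scale` over the OPEN base via `KZ.of_sub_of_mem_relations_of_affine`) decides every pair #23 #34 #35 #38–#49 of the cell census as an INTEGER relation (normal forms R1≡2A, R2≡4A−4W, R3≡2A−T, R4≡4W−2T, R5≡2W+2T, R6≡3W, 2T≡A, 3W≡2A); packaged `zetaTwoStratum_descentTwoQ_instances` and `zetaTwoPair_of_kzDimTwo` BY NAME.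

Source: `HOME/decomp-kz-lens-6/g8/ZetaTwoPairs.lean` sha256 a8aac2aea5cc880c (1299 l; critic decomp-kz-crit-1 g2 CLEARED 2026-08-30T09:03:21Z, std axioms), split into 5 modules by the landing seat decomp-kz-census-1 g7 (contexts re-opened per part; generic docstrings added where the source had none; the route file is imported only by the last part, which proves the `KZDimTwo` corollaries BY NAME).  No `sorry`; standard axioms.  References: [cite: KontsevichZagier2001, §1.2].
-/

noncomputable section

open MeasureTheory Set MvPolynomial

namespace Summit.KontsevichZagierPeriods.RootDecompQuadraticDescent.ZetaTwoPairs

open Literature.NumberTheory.Transcendental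
open Literature.NumberTheory.Transcendental.KZ
open Literature.ModelTheory.ExponentialFields (IsSemialgebraic)

-- PRIVATE copy (landed twin lives in a farm-unbuilt module; dedup.landed): snoc2_zero, snoc2_one, init2_zero, last_one_eq
/-- `snoc2_zero`: auxiliary theorem of the lens-6 development «zeta2» (instances of 28994/4280) — see the module docstring; verbatim from the lens file. -/
@[simp] private theorem snoc2_zero (x : Fin 1 → ℝ) (t : ℝ) : (Fin.snoc x t : Fin 2 → ℝ) 0 = x 0 := rfl

/-- `snoc2_one`: auxiliary theorem of the lens-6 development «zeta2» (instances of 28994/4280) — see the module docstring; verbatim from the lens file. -/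
@[simp] private theorem snoc2_one (x : Fin 1 → ℝ) (t : ℝ) : (Fin.snoc x t : Fin 2 → ℝ) 1 = t := rfl

/-- `init2_zero`: auxiliary theorem of the lens-6 development «zeta2» (instances of 28994/4280) — see the module docstring; verbatim from the lens file. -/
@[simp] private theorem init2_zero (z : Fin 2 → ℝ) : Fin.init z 0 = z 0 := rfl

/-- `last_one_eq`: auxiliary theorem of the lens-6 development «zeta2» (instances of 28994/4280) — see the module docstring; verbatim from the lens file. -/
private theorem last_one_eq : (Fin.last 1 : Fin 2) = 1 := rfl

/-- **(scale)** the fibre scaling `σ = tʲ·τ` over the OPEN base (rule 2, Literature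
`KZ.of_sub_of_mem_relations_of_affine`; the Jacobian `tʲ` vanishes at `t = 0`, whence the open
base): `[osbDom(0, gp), c tʲ/(1 + tʲ⁺¹ τ)] ≡ [osbDom(0, gk), c/(1 + tσ)]` for `gk = tʲ·gp`. -/
theorem rel_scale (j : ℕ) (c : ℚ) (gp gk : Edge) (hgk : ∀ t ∈ Icc (0 : ℝ) 1, gk.f t = t ^ j * gp.f t) :
    KZ.of (opn (RA j c gp) zeroE gp rfl) - KZ.of (opn (SB c zeroE gk) zeroE gk rfl) ∈ KZ.relations := by
  refine KZ.of_sub_of_mem_relations_of_affine (G := oivl) isOpen_oivl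
    (α := fun _ => (0 : ℝ)) (β := fun y => y 0 ^ j)
    (a := fun y => zeroE.f (y 0)) (b := fun y => gp.f (y 0)) (a' := fun y => zeroE.f (y 0))
    (b' := fun y => gk.f (y 0)) ?_ ?_ ?_ ?_ ?_
    (opn (RA j c gp) zeroE gp rfl) (opn (SB c zeroE gk) zeroE gk rfl) rfl rfl ?_ ?_ ?_
  · simpa using isSemialgebraicFunOn_ratCast isSemialgebraic_oivl 0
  · simpa using isSemialgebraicFunOn_aeval isSemialgebraic_oivl (X 0 ^ j : MvPolynomial (Fin 1) ℚ)
  · exact differentiableOn_const _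
  · fun_prop
  · intro y hy; exact pow_pos hy.1 _
  · intro y _; simp
  · intro y hy
    rw [zero_add]
    exact hgk _ (I01 (oivl_subset hy))
  · intro z hz
    have hz' : z ∈ sbDom zeroE gp := osbDom_subset _ _ hz
    have h0 := (z0_mem hz').1
    have h1 : 0 ≤ z 1 := by simpa using (mem_sbDom.1 hz').2.1
    show (RA j c gp).integrand z = (SB c zeroE gk).integrand _ * _
    rw [RA_integrand, SB_integrand]
    simp only [snoc2_zero, snoc2_one, init2_zero, zero_add, last_one_eq]
    have h2 : z 0 * (z 0 ^ j * z 1) = z 0 ^ (j + 1) * z 1 := by ring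
    rw [h2, div_mul_eq_mul_div]

/-- **(shift)** the fibre translation `s = 1 + τ` (rule 2, `KZ.of_sub_of_mem_relations_of_fibreMap`). -/
theorem rel_shift (g : Edge) (R R' : KZ.IntegralRep 2) (hR : R.domain = sbDom zeroE g)
    (hR' : R'.domain = sbDom oneE g.onePlus)
    (hint : ∀ z ∈ sbDom zeroE g, R.integrand z = R'.integrand (Fin.snoc (Fin.init z) (1 + z 1))) :
    KZ.of R - KZ.of R' ∈ KZ.relations := by
  have hB : IsSemialgebraic ℚ R.domain := R.isSemialgebraic_domain
  refine of_sub_of_mem_relations_of_fibreMap (G := ivl 0 1) (a := fun y => zeroE.f (y 0))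
    (b := fun y => g.f (y 0)) (a' := fun y => oneE.f (y 0)) (b' := fun y => g.onePlus.f (y 0))
    (fun z => 1 + z 1) (fun _ => (1 : ℝ)) R R' hR hR' (fun y hy => ?_) ?_ ?_ ?_ ?_ ?_ ?_ ?_
  · simpa using g.nonneg _ (I01 hy)
  · have h1 : IsSemialgebraicFunOn ℚ R.domain (fun z : Fin 2 → ℝ => z 1) := by
      simpa using isSemialgebraicFunOn_aeval hB (X 1 : MvPolynomial (Fin 2) ℚ)
    have hone : IsSemialgebraicFunOn ℚ R.domain (fun _ : Fin 2 → ℝ => (1 : ℝ)) := by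
      simpa using isSemialgebraicFunOn_ratCast hB 1
    exact (IsSemialgebraicFunOn.add_holds hone h1).congr fun z _ => by simp only [Pi.add_apply]
  · intro z _; fun_prop
  · intro z _
    show HasDerivAt (fun t => 1 + (Fin.snoc (Fin.init z) t : Fin 2 → ℝ) 1) 1 (z 1)
    simp only [snoc2_one]
    exact (hasDerivAt_id' (z 1)).const_add 1
  · intro z _; exact one_pos
  · intro y _
    show 1 + (Fin.snoc y (zeroE.f (y 0)) : Fin 2 → ℝ) 1 = oneE.f (y 0)
    simp
  · intro y _
    show 1 + (Fin.snoc y (g.f (y 0)) : Fin 2 → ℝ) 1 = g.onePlus.f (y 0)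
    simp
  · intro z hz
    rw [hint z (by rw [← hR]; exact hz), mul_one]

/-- Injectivity and image of an interval under a map with positive derivative in the interior. -/
theorem injOn_image_of_deriv_pos' {κ κd : ℝ → ℝ} {a b : ℝ} (hab : a ≤ b)
    (hκd : ∀ t ∈ Icc a b, HasDerivAt κ (κd t) t) (hpos : ∀ t ∈ Ioo a b, 0 < κd t) :
    InjOn κ (Icc a b) ∧ κ '' Icc a b = Icc (κ a) (κ b) := by
  have hc : ContinuousOn κ (Icc a b) := fun t ht => (hκd t ht).continuousAt.continuousWithinAt
  have hm : StrictMonoOn κ (Icc a b) := strictMonoOn_of_deriv_pos (convex_Icc a b) hc fun t ht => by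
    rw [interior_Icc] at ht
    rw [(hκd t (Ioo_subset_Icc_self ht)).deriv]
    exact hpos t ht
  refine ⟨hm.injOn, Subset.antisymm ?_ (intermediate_value_Icc hab hc)⟩
  rintro _ ⟨t, ht, rfl⟩
  exact ⟨hm.monotoneOn (left_mem_Icc.2 hab) ht ht.1, hm.monotoneOn ht (right_mem_Icc.2 hab) ht.2⟩

/-- **(base power)** the base substitution `u = tʲ⁺¹` lifted to the shifted band (rule 2,
Literature `KZ.of_sub_of_mem_relations_covLift`): Jacobian `(j+1)·tʲ`. -/
theorem rel_powB (j : ℕ) (gp g : Edge) (hgp : ∀ t ∈ Icc (0 : ℝ) 1, gp.f t = g.f (t ^ (j + 1)))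
    (R R' : KZ.IntegralRep 2) (hR : R.domain = sbDom oneE gp.onePlus)
    (hR' : R'.domain = sbDom oneE g.onePlus)
    (hint : ∀ z ∈ sbDom oneE gp.onePlus, R.integrand z =
      R'.integrand (Fin.snoc (fun _ : Fin 1 => z 0 ^ (j + 1)) (z 1)) * (((j : ℝ) + 1) * z 0 ^ j)) :
    KZ.of R - KZ.of R' ∈ KZ.relations := by
  have hσ := isSemialgebraic_ivl 0 1
  obtain ⟨κ, hκ⟩ : ∃ κ : ℝ → ℝ, κ = fun t => t ^ (j + 1) := ⟨_, rfl⟩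
  obtain ⟨κd, hκd'⟩ : ∃ κd : ℝ → ℝ, κd = fun t => ((j : ℝ) + 1) * t ^ j := ⟨_, rfl⟩
  have hκd : ∀ t : ℝ, HasDerivAt κ (κd t) t := fun t => by
    rw [hκ, hκd']
    simpa using hasDerivAt_pow (j + 1) t
  let Φ : (Fin 1 → ℝ) → (Fin 1 → ℝ) := fun y _ => κ (y 0)
  let Φ' : (Fin 1 → ℝ) → (Fin 1 → ℝ) →L[ℝ] (Fin 1 → ℝ) := fun y =>
    κd (y 0) • ContinuousLinearMap.id ℝ (Fin 1 → ℝ)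
  have hdet : ∀ y, (Φ' y).det = κd (y 0) := fun y => by
    simp only [Φ', ContinuousLinearMap.det, ContinuousLinearMap.toLinearMap_smul,
      ContinuousLinearMap.coe_id, LinearMap.det_smul, LinearMap.det_id, Module.finrank_fin_fun,
      pow_one, mul_one]
  obtain ⟨hinj, himg⟩ := injOn_image_of_deriv_pos' (κ := κ) (κd := κd) (a := (0 : ℝ)) (b := 1)
    zero_le_one (fun t _ => hκd t) (fun t ht => by have := ht.1; rw [hκd']; positivity)
  have hκ0 : κ 0 = 0 := by rw [hκ]; simp
  have hκ1 : κ 1 = 1 := by rw [hκ]; simp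
  rw [hκ0, hκ1] at himg
  have himage : Φ '' ivl 0 1 = ivl 0 1 := by
    ext w
    constructor
    · rintro ⟨y, hy, rfl⟩
      have : κ (y 0) ∈ Icc (0 : ℝ) 1 := by rw [← himg]; exact mem_image_of_mem κ (I01 hy)
      rw [mem_ivl]; push_cast; exact this
    · intro hw
      obtain ⟨t, ht, htw⟩ : w 0 ∈ κ '' Icc (0 : ℝ) 1 := by rw [himg]; exact I01 hw
      refine ⟨fun _ => t, ?_, ?_⟩
      · show ((0 : ℚ) : ℝ) ≤ t ∧ t ≤ ((1 : ℚ) : ℝ); push_cast; exact ht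
      · funext i
        rw [Fin.fin_one_eq_zero i]
        exact htw
  refine KZ.of_sub_of_mem_relations_covLift (σ := ivl 0 1) (Φ := Φ) (Φ' := Φ')
    (v := fun y => gp.onePlus.f (y 0)) (v' := fun y => g.onePlus.f (y 0)) ?_ ?_ ?_ (fun y hy => ?_)
    R R' hR (by rw [himage]; exact hR') fun z hz => ?_
  · exact (isSemialgebraicMapOn_iff_forall_holds hσ).mpr fun _ =>
      (isSemialgebraicFunOn_aeval hσ (X 0 ^ (j + 1) : MvPolynomial (Fin 1) ℚ)).congr fun y _ => by
        show aeval y (X 0 ^ (j + 1) : MvPolynomial (Fin 1) ℚ) = κ (y 0)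
        rw [hκ]; simp
  · intro y _
    have h1 : HasFDerivAt (fun y : Fin 1 → ℝ => κ (y 0))
        (κd (y 0) • ContinuousLinearMap.proj (R := ℝ) (φ := fun _ : Fin 1 => ℝ) 0) y :=
      (hκd _).comp_hasFDerivAt y (hasFDerivAt_apply 0 y)
    have h2 : HasFDerivAt Φ (ContinuousLinearMap.pi fun _ : Fin 1 =>
        κd (y 0) • ContinuousLinearMap.proj (R := ℝ) (φ := fun _ : Fin 1 => ℝ) 0) y :=
      hasFDerivAt_pi.2 fun _ => h1
    have h3 : (ContinuousLinearMap.pi fun _ : Fin 1 =>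
        κd (y 0) • ContinuousLinearMap.proj (R := ℝ) (φ := fun _ : Fin 1 => ℝ) 0) = Φ' y := by
      ext w i
      rw [Fin.fin_one_eq_zero i]
      simp [Φ']
    exact (h3 ▸ h2).hasFDerivWithinAt
  · intro y₁ hy₁ y₂ hy₂ h
    have h0 : κ (y₁ 0) = κ (y₂ 0) := congrFun h 0
    funext i
    rw [Fin.fin_one_eq_zero i]
    exact hinj (I01 hy₁) (I01 hy₂) h0
  · show 1 + gp.f (y 0) = 1 + g.f (κ (y 0))
    rw [hgp _ (I01 hy), hκ]
  · have hz' : z ∈ sbDom oneE gp.onePlus := by rw [← hR]; exact hz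
    have h0 := (z0_mem hz').1
    rw [hdet, hint z hz']
    show _ = R'.integrand (Fin.snoc (fun _ : Fin 1 => κ (z 0)) (z 1)) * |κd (z 0)|
    rw [hκ, hκd', abs_of_nonneg (by positivity)]

/-- **(power map `P_{j+1}`)** `B(φ(tʲ⁺¹)) ≡ B(φ)/(j+1)`: for edges `g` (`= (φ−1)/u`), `gp = g(tʲ⁺¹)`,
`gk = tʲ·gp` and weights `c = (j+1)·c'`, `SB(c; 0, gk) ≡ SB(c'; 0, g)` — six moves of rules 1a + 2. -/
theorem sb_pow (j : ℕ) (c c' : ℚ) (hc : c = (j + 1) * c') (g gp gk : Edge)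
    (hgp : ∀ t ∈ Icc (0 : ℝ) 1, gp.f t = g.f (t ^ (j + 1)))
    (hgk : ∀ t ∈ Icc (0 : ℝ) 1, gk.f t = t ^ j * gp.f t) :
    KZ.of (SB c zeroE gk) - KZ.of (SB c' zeroE g) ∈ KZ.relations := by
  have e1 := rel_opn (SB c zeroE gk) zeroE gk rfl
  have e2 := rel_scale j c gp gk hgk
  have e3 := rel_opn (RA j c gp) zeroE gp rfl
  have e4 : KZ.of (RA j c gp) - KZ.of (RS j c gp) ∈ KZ.relations :=
    rel_shift gp (RA j c gp) (RS j c gp) rfl rfl fun z _ => by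
      rw [RA_integrand, RS_integrand]
      simp only [snoc2_zero, snoc2_one, init2_zero, add_sub_cancel_left]
  have e5 : KZ.of (RS j c gp) - KZ.of (RS' c' g) ∈ KZ.relations :=
    rel_powB j gp g hgp (RS j c gp) (RS' c' g) rfl rfl fun z hz => by
      have h0 := (z0_mem hz).1
      have h1 : 0 ≤ z 1 - 1 := by have := (mem_sbDom.1 hz).2.1; simp at this; linarith
      have hD : (1 : ℝ) + z 0 ^ (j + 1) * (z 1 - 1) ≠ 0 := by
        nlinarith [mul_nonneg (pow_nonneg h0 (j + 1)) h1]
      have hj : (j : ℝ) + 1 ≠ 0 := by positivity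
      rw [RS_integrand, RS'_integrand]
      simp only [snoc2_zero, snoc2_one, hc]
      push_cast
      field_simp
  have e6 : KZ.of (SB c' zeroE g) - KZ.of (RS' c' g) ∈ KZ.relations :=
    rel_shift g (SB c' zeroE g) (RS' c' g) rfl rfl fun z _ => by
      rw [SB_integrand, RS'_integrand]
      simp only [snoc2_zero, snoc2_one, init2_zero, add_sub_cancel_left]
  have h := sub_mem (add_mem (add_mem (sub_mem (sub_mem e1 e2) e3) e4) e5) e6
  convert h using 1
  abel

/-! ## §4 Edges and the generic chains (every relation at an arbitrary weight `c`) -/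

/-- `D1_pos`: auxiliary theorem of the lens-6 development «zeta2» (instances of 28994/4280) — see the module docstring; verbatim from the lens file. -/
private theorem D1_pos (t : ℝ) : 0 < 1 - t + t ^ 2 := by nlinarith [sq_nonneg (t - 1 / 2)]

/-- The edges `2 + t`, `2/(1+t²)`, `t²`, `(1−t)/(1−t+t²)`, `1 + t`, `1 + t²`, `t + t³`,
`1/(1+t+t²)`, `1/(1+t²)`, `1/(1−t+t²)`, `2/(1−t+t²)`. -/
def twoPlusE : Edge := mkEdge (fun t => 2 + t) (2 + X 0) 1 (fun y _ => by simp)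
  (fun y _ => by simp) (fun t ht => by linarith [ht.1]) (by fun_prop)
/-- `gE`: auxiliary def of the lens-6 development «zeta2» (instances of 28994/4280) — see the module docstring; verbatim from the lens file. -/
def gE : Edge := mkEdge (fun t => 2 / (1 + t ^ 2)) 2 (1 + X 0 ^ 2)
  (fun y _ => by simp only [map_add, map_one, map_pow, aeval_X]; positivity)
  (fun y _ => by simp) (fun t _ => by positivity)
  (ContinuousOn.div continuousOn_const (by fun_prop) fun t _ => by positivity)
/-- `sqE`: auxiliary def of the lens-6 development «zeta2» (instances of 28994/4280) — see the module docstring; verbatim from the lens file. -/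
def sqE : Edge := mkEdge (fun t => t ^ 2) (X 0 ^ 2) 1 (fun y _ => by simp) (fun y _ => by simp)
  (fun t _ => by positivity) (by fun_prop)
/-- `yE`: auxiliary def of the lens-6 development «zeta2» (instances of 28994/4280) — see the module docstring; verbatim from the lens file. -/
def yE : Edge := mkEdge (fun t => (1 - t) / (1 - t + t ^ 2)) (1 - X 0) (1 - X 0 + X 0 ^ 2)
  (fun y _ => by simp only [map_add, map_sub, map_one, map_pow, aeval_X]; exact (D1_pos _).ne')
  (fun y _ => by simp) (fun t ht => div_nonneg (by linarith [ht.2]) (D1_pos t).le)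
  (ContinuousOn.div (by fun_prop) (by fun_prop) fun t _ => (D1_pos t).ne')
/-- `opIdE`: auxiliary def of the lens-6 development «zeta2» (instances of 28994/4280) — see the module docstring; verbatim from the lens file. -/
def opIdE : Edge := mkEdge (fun t => 1 + t) (1 + X 0) 1 (fun y _ => by simp) (fun y _ => by simp)
  (fun t ht => by linarith [ht.1]) (by fun_prop)
/-- `opSqE`: auxiliary def of the lens-6 development «zeta2» (instances of 28994/4280) — see the module docstring; verbatim from the lens file. -/
def opSqE : Edge := mkEdge (fun t => 1 + t ^ 2) (1 + X 0 ^ 2) 1 (fun y _ => by simp)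
  (fun y _ => by simp) (fun t _ => by positivity) (by fun_prop)
/-- `tCubE`: auxiliary def of the lens-6 development «zeta2» (instances of 28994/4280) — see the module docstring; verbatim from the lens file. -/
def tCubE : Edge := mkEdge (fun t => t + t ^ 3) (X 0 + X 0 ^ 3) 1 (fun y _ => by simp)
  (fun y _ => by simp) (fun t ht => by have := ht.1; positivity) (by fun_prop)
/-- `r2E`: auxiliary def of the lens-6 development «zeta2» (instances of 28994/4280) — see the module docstring; verbatim from the lens file. -/
def r2E : Edge := mkEdge (fun t => 1 / (1 + t + t ^ 2)) 1 (1 + X 0 + X 0 ^ 2)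
  (fun y hy => by
    have := (I01 hy).1; simp only [map_add, map_one, map_pow, aeval_X]; positivity)
  (fun y _ => by simp) (fun t ht => by have := ht.1; positivity)
  (ContinuousOn.div (by fun_prop) (by fun_prop) fun t ht => by have := ht.1; positivity)
/-- `r4E`: auxiliary def of the lens-6 development «zeta2» (instances of 28994/4280) — see the module docstring; verbatim from the lens file. -/
def r4E : Edge := mkEdge (fun t => 1 / (1 + t ^ 2)) 1 (1 + X 0 ^ 2)
  (fun y _ => by simp only [map_add, map_one, map_pow, aeval_X]; positivity)
  (fun y _ => by simp) (fun t _ => by positivity)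
  (ContinuousOn.div (by fun_prop) (by fun_prop) fun t _ => by positivity)
/-- `r5E`: auxiliary def of the lens-6 development «zeta2» (instances of 28994/4280) — see the module docstring; verbatim from the lens file. -/
def r5E : Edge := mkEdge (fun t => 1 / (1 - t + t ^ 2)) 1 (1 - X 0 + X 0 ^ 2)
  (fun y _ => by simp only [map_add, map_sub, map_one, map_pow, aeval_X]; exact (D1_pos _).ne')
  (fun y _ => by simp) (fun t _ => div_nonneg zero_le_one (D1_pos t).le)
  (ContinuousOn.div (by fun_prop) (by fun_prop) fun t _ => (D1_pos t).ne')
/-- `r6E`: auxiliary def of the lens-6 development «zeta2» (instances of 28994/4280) — see the module docstring; verbatim from the lens file. -/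
def r6E : Edge := mkEdge (fun t => 2 / (1 - t + t ^ 2)) 2 (1 - X 0 + X 0 ^ 2)
  (fun y _ => by simp only [map_add, map_sub, map_one, map_pow, aeval_X]; exact (D1_pos _).ne')
  (fun y _ => by simp) (fun t _ => div_nonneg zero_le_two (D1_pos t).le)
  (ContinuousOn.div (by fun_prop) (by fun_prop) fun t _ => (D1_pos t).ne')

/-- `twoPlusE_f`: auxiliary theorem of the lens-6 development «zeta2» (instances of 28994/4280) — see the module docstring; verbatim from the lens file. -/
@[simp] theorem twoPlusE_f (t : ℝ) : twoPlusE.f t = 2 + t := rfl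
/-- `gE_f`: auxiliary theorem of the lens-6 development «zeta2» (instances of 28994/4280) — see the module docstring; verbatim from the lens file. -/
@[simp] theorem gE_f (t : ℝ) : gE.f t = 2 / (1 + t ^ 2) := rfl
/-- `sqE_f`: auxiliary theorem of the lens-6 development «zeta2» (instances of 28994/4280) — see the module docstring; verbatim from the lens file. -/
@[simp] private theorem sqE_f (t : ℝ) : sqE.f t = t ^ 2 := rfl
/-- `yE_f`: auxiliary theorem of the lens-6 development «zeta2» (instances of 28994/4280) — see the module docstring; verbatim from the lens file. -/
@[simp] theorem yE_f (t : ℝ) : yE.f t = (1 - t) / (1 - t + t ^ 2) := rfl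
/-- `opIdE_f`: auxiliary theorem of the lens-6 development «zeta2» (instances of 28994/4280) — see the module docstring; verbatim from the lens file. -/
@[simp] theorem opIdE_f (t : ℝ) : opIdE.f t = 1 + t := rfl
/-- `opSqE_f`: auxiliary theorem of the lens-6 development «zeta2» (instances of 28994/4280) — see the module docstring; verbatim from the lens file. -/
@[simp] private theorem opSqE_f (t : ℝ) : opSqE.f t = 1 + t ^ 2 := rfl
/-- `tCubE_f`: auxiliary theorem of the lens-6 development «zeta2» (instances of 28994/4280) — see the module docstring; verbatim from the lens file. -/
@[simp] theorem tCubE_f (t : ℝ) : tCubE.f t = t + t ^ 3 := rfl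
/-- `r2E_f`: auxiliary theorem of the lens-6 development «zeta2» (instances of 28994/4280) — see the module docstring; verbatim from the lens file. -/
@[simp] theorem r2E_f (t : ℝ) : r2E.f t = 1 / (1 + t + t ^ 2) := rfl
/-- `r4E_f`: auxiliary theorem of the lens-6 development «zeta2» (instances of 28994/4280) — see the module docstring; verbatim from the lens file. -/
@[simp] theorem r4E_f (t : ℝ) : r4E.f t = 1 / (1 + t ^ 2) := rfl
/-- `r5E_f`: auxiliary theorem of the lens-6 development «zeta2» (instances of 28994/4280) — see the module docstring; verbatim from the lens file. -/
@[simp] theorem r5E_f (t : ℝ) : r5E.f t = 1 / (1 - t + t ^ 2) := rfl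
/-- `r6E_f`: auxiliary theorem of the lens-6 development «zeta2» (instances of 28994/4280) — see the module docstring; verbatim from the lens file. -/
@[simp] theorem r6E_f (t : ℝ) : r6E.f t = 2 / (1 - t + t ^ 2) := rfl

/-! ### The generators at weight `c`:
`Q = SB(c;0,1) = B(1+t)`, `Tl = SB(c;0,t) = B(1+t²)`, `C3 = SB(c;0,t²) = B(1+t³)`,
`Y = SB(c;0,(1−t)/(1−t+t²)) = B(1/(1−t+t²))`, `X = SB(c;0,1+t) = B(1+t+t²)`,
`X4 = SB(c;0,t+t³) = B(1+t²+t⁴)`, `P = SB(c;0,2+t) = B((1+t)²)`,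
and the unfolded cube integrands `G = SB(c;0,2/(1+t²))`, `G2 = SB(c;0,1/(1+t+t²))`,
`G4 = SB(c;0,1/(1+t²))`, `G5 = SB(c;0,1/(1−t+t²))`, `G6 = SB(c;0,2/(1−t+t²))`. -/

/-- `2·Tl ≡ Q`: `Q ≡ Tl + Tu` (cut along the diagonal) and `Tl ≡ Tu` (swap). -/
theorem tl_rel (c : ℚ) : 2 • KZ.of (SB c zeroE idE) - KZ.of (SB c zeroE oneE) ∈ KZ.relations := by
  have h1 := sb_cut c zeroE idE oneE (fun t ht => by simpa using ht.1) (fun t ht => by simpa using ht.2)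
  have h2 := sb_swap c
  have h := sub_mem h2 h1
  convert h using 1
  abel

/-- `3·C3 ≡ Q`: the power map `P₃` applied to `φ = 1 + u` (`B(1+t³) = B(1+t)/3`). -/
theorem c3_rel (c : ℚ) : 3 • KZ.of (SB c zeroE sqE) - KZ.of (SB c zeroE oneE) ∈ KZ.relations := by
  have h1 := sb_pow 2 c (c / 3) (by ring) oneE oneE sqE (fun t _ => by simp) (fun t _ => by simp)
  have h2 := sb_third c zeroE oneE
  have h := sub_mem (KZ.relations.zsmul_mem h1 3) h2
  convert h using 1
  module

/-- `3·Y ≡ 2·Q`: `Q ≡ C3 + SB(c; t², 1)` (cut), `SB(c; t², 1) ≡ Y` (affine map `σ = t² + (1+t³)τ`,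
i.e. `B(1+t) = B(1+t³) + B(1/(1−t+t²))`), and `3·C3 ≡ Q`. -/
theorem y_rel (c : ℚ) : 3 • KZ.of (SB c zeroE yE) - 2 • KZ.of (SB c zeroE oneE) ∈ KZ.relations := by
  have h1 := sb_cut c zeroE sqE oneE (fun t _ => by simp; positivity)
    (fun t ht => by simp only [sqE_f, oneE_f]; exact pow_le_one₀ ht.1 ht.2)
  have h2 := sb_affine c sqE oneE yE (by show Differentiable ℝ fun t : ℝ => t ^ 2; fun_prop)
    fun t _ => by
      have hD := (D1_pos t).ne'
      simp only [oneE_f, sqE_f, yE_f]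
      field_simp
      ring
  have h3 := c3_rel c
  have h := sub_mem (sub_mem (KZ.relations.zsmul_mem h2 3) (KZ.relations.zsmul_mem h1 3)) h3
  convert h using 1
  module

end Summit.KontsevichZagierPeriods.RootDecompQuadraticDescent.ZetaTwoPairs

end
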